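import Summits.Ventures.YMGap.Thresholds.HaarThirdMomentSU3
import HarnessLib

/-!
# The centre selection rule for `SU(N)` character moments: `∫ (tr U)^j (conj tr U)^k dU = 0` unless `N ∣ j − k`
# (row type C-PRESS, `β = 0` inputs, part 20)

Cell `pub-ymgap`, seat ds-1 (gen 11). HONEST FRAMING: pure compact-group integration for a compact group `G ≅ SU(N)`
(`IsSpecialUnitaryModel ρ`), `N ≥ 1`; nothing lattice-specific, nothing about the continuum or the Clay problem. Kernel theorems only,
0 compute, no definitions.

The centre element `ζ·1 ∈ SU(N)`, `ζ = e^{2πi/N}` (`smul_one_mem`), multiplies `tr ρ(g)` by `ζ` and `conj tr ρ(g)` by `ζ̄ = ζ⁻¹`; Haar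
invariance (`integral_comp_mul_left`) therefore multiplies `M_{j,k} := ∫ (tr ρ)^j (conj tr ρ)^k` by `ζ^j ζ̄^k = ζ^{j−k}`, which is `≠ 1`
exactly when `N ∤ j − k` (`IsPrimitiveRoot.zpow_eq_one_iff_dvd`). Hence ★★ `integral_trace_pow_mul_conj_pow_eq_zero`:
`M_{j,k} = 0` whenever `¬ (N : ℤ) ∣ j − k` — the selection rule behind `∫ tr² = 0` (`N ≥ 3`, rb-p2), `∫ tr³ = 0` (`N ∤ 3`, part 14b),
`∫ tr⁴ = 0` (`N ∤ 4`, part 19d), `∫ tr² t̄r = 0` (`N ≥ 2`, part 14b's `integral_trace_sq_mul_conj_trace_eq_zero`), and in general the vanishing of all "charged" moments of the Polyakov/plaquette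
character (ℤ_N centre symmetry). Special cases drawn: `integral_trace_pow_eq_zero` (`k = 0`, `N ∤ j`) and
`integral_trace_pow_succ_mul_conj_pow_eq_zero` (`j = k + m`, `N ∤ m`). References: P. Diaconis, M. Shahshahani, J. Appl. Probab. 31A
(1994) 49; M. Creutz, *Quarks, gluons and lattices* (1983) §8. Everything here is proved. [folklore]
-/

noncomputable section

open MeasureTheory Complex
open Literature.MathematicalPhysics.QuantumLattice Literature.MathematicalPhysics.QuantumFieldTheory

namespace Summit.Ventures.YMGap.HaarCentreTwist

open RobustBall.HaarSecondMoments (integral_comp_mul_left smul_one_mem)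
open HaarThirdMomentSU3 (eq_zero_of_mul_eq_self)

section Model

variable {N : ℕ} {G : Type*} [Group G] [TopologicalSpace G] [IsTopologicalGroup G] [CompactSpace G]
  [MeasurableSpace G] [BorelSpace G] (ρ : G →* Matrix (Fin N) (Fin N) ℂ)

/-- **The twist relation**: `∫ (tr ρ)^j (conj tr ρ)^k = ζ^j ζ̄^k · ∫ (tr ρ)^j (conj tr ρ)^k` for the centre phase `ζ = e^{2πi/N}`.
[folklore] -/
theorem integral_trace_pow_mul_conj_pow_twist (hρ : IsSpecialUnitaryModel ρ) (hN : N ≠ 0) (j k : ℕ) :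
    ∫ g, (ρ g).trace ^ j * (starRingEnd ℂ) (ρ g).trace ^ k ∂haarProbability G =
      (Complex.exp (2 * Real.pi * Complex.I / N) ^ j * (starRingEnd ℂ) (Complex.exp (2 * Real.pi * Complex.I / N)) ^ k) *
        ∫ g, (ρ g).trace ^ j * (starRingEnd ℂ) (ρ g).trace ^ k ∂haarProbability G := by
  set ζ : ℂ := Complex.exp (2 * Real.pi * Complex.I / N) with hζdef
  have hmem : ζ • (1 : Matrix (Fin N) (Fin N) ℂ) ∈ Matrix.specialUnitaryGroup (Fin N) ℂ := by
    rw [hζdef]; exact smul_one_mem (N := N) hN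
  have h := integral_comp_mul_left ρ hρ hmem (fun M => M.trace ^ j * (starRingEnd ℂ) M.trace ^ k)
  have ht : ∀ M : Matrix (Fin N) (Fin N) ℂ, (ζ • (1 : Matrix (Fin N) (Fin N) ℂ) * M).trace ^ j *
      (starRingEnd ℂ) (ζ • (1 : Matrix (Fin N) (Fin N) ℂ) * M).trace ^ k =
      (ζ ^ j * (starRingEnd ℂ) ζ ^ k) * (M.trace ^ j * (starRingEnd ℂ) M.trace ^ k) := by
    intro M
    rw [smul_mul_assoc, one_mul, Matrix.trace_smul, smul_eq_mul, map_mul, mul_pow, mul_pow]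
    ring
  simp only [ht] at h
  rw [integral_const_mul] at h
  exact h.symm

/-- The twist factor `ζ^j ζ̄^k` equals `1` iff `N ∣ j − k` (as integers), for the primitive root `ζ = e^{2πi/N}`. [folklore] -/
theorem twist_factor_ne_one (hN : N ≠ 0) {j k : ℕ} (hjk : ¬ ((N : ℤ) ∣ (j : ℤ) - k)) :
    Complex.exp (2 * Real.pi * Complex.I / N) ^ j * (starRingEnd ℂ) (Complex.exp (2 * Real.pi * Complex.I / N)) ^ k ≠ 1 := by
  set ζ : ℂ := Complex.exp (2 * Real.pi * Complex.I / N) with hζdef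
  have hprim : IsPrimitiveRoot ζ N := Complex.isPrimitiveRoot_exp N hN
  have hζ0 : ζ ≠ 0 := hprim.ne_zero hN
  have hnorm : ‖ζ‖ = 1 := hprim.norm'_eq_one hN
  have hmul : ζ * (starRingEnd ℂ) ζ = 1 := by
    rw [Complex.mul_conj, Complex.normSq_eq_norm_sq, hnorm]; simp
  have hconj : (starRingEnd ℂ) ζ = ζ⁻¹ := eq_inv_of_mul_eq_one_right hmul
  rw [hconj, inv_pow, ← zpow_natCast, ← zpow_natCast, ← zpow_neg, ← zpow_add₀ hζ0]
  intro h
  have h' : ζ ^ ((j : ℤ) - k) = 1 := by rw [sub_eq_add_neg]; exact h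
  exact hjk ((hprim.zpow_eq_one_iff_dvd ((j : ℤ) - k)).mp h')

/-- ★★ **THE CENTRE SELECTION RULE**: `∫ (tr ρ(g))^j (conj tr ρ(g))^k dg = 0` whenever `N ∤ j − k`, for every compact group
`G ≅ SU(N)`, `N ≥ 1`. [folklore] -/
theorem integral_trace_pow_mul_conj_pow_eq_zero (hρ : IsSpecialUnitaryModel ρ) (hN : N ≠ 0) {j k : ℕ}
    (hjk : ¬ ((N : ℤ) ∣ (j : ℤ) - k)) :
    ∫ g, (ρ g).trace ^ j * (starRingEnd ℂ) (ρ g).trace ^ k ∂haarProbability G = 0 :=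
  eq_zero_of_mul_eq_self (twist_factor_ne_one hN hjk) (integral_trace_pow_mul_conj_pow_twist ρ hρ hN j k).symm

/-- ★ **`∫ (tr ρ(g))^j dg = 0` whenever `N ∤ j`** (`k = 0`). [folklore] -/
theorem integral_trace_pow_eq_zero (hρ : IsSpecialUnitaryModel ρ) (hN : N ≠ 0) {j : ℕ} (hj : ¬ N ∣ j) :
    ∫ g, (ρ g).trace ^ j ∂haarProbability G = 0 := by
  have hjk : ¬ ((N : ℤ) ∣ (j : ℤ) - (0 : ℕ)) := by
    rw [Nat.cast_zero, sub_zero]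
    exact fun h => hj (Int.natCast_dvd_natCast.mp h)
  have h := integral_trace_pow_mul_conj_pow_eq_zero ρ hρ hN hjk
  simpa using h

/-- ★ **`∫ (tr ρ(g))^{k+m} (conj tr ρ(g))^k dg = 0` whenever `N ∤ m`** (net charge `m`). [folklore] -/
theorem integral_trace_pow_add_mul_conj_pow_eq_zero (hρ : IsSpecialUnitaryModel ρ) (hN : N ≠ 0) (k : ℕ) {m : ℕ} (hm : ¬ N ∣ m) :
    ∫ g, (ρ g).trace ^ (k + m) * (starRingEnd ℂ) (ρ g).trace ^ k ∂haarProbability G = 0 := by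
  refine integral_trace_pow_mul_conj_pow_eq_zero ρ hρ hN ?_
  rw [Nat.cast_add, add_sub_cancel_left]
  exact fun h => hm (Int.natCast_dvd_natCast.mp h)

/-- **The mean of the character vanishes for `N ≥ 2`**: `∫ tr ρ(g) dg = 0`. [folklore] -/
theorem integral_trace_eq_zero (hρ : IsSpecialUnitaryModel ρ) (hN : 2 ≤ N) :
    ∫ g, (ρ g).trace ∂haarProbability G = 0 := by
  have h := integral_trace_pow_eq_zero ρ hρ (by omega) (j := 1)
    (fun h => by have := Nat.le_of_dvd one_pos h; omega)
  simpa using h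

/-- **`∫ (tr ρ(g))⁵ dg = 0` for `N ∉ {1, 5}`**, e.g. for `SU(2)`, `SU(3)`, `SU(4)` and every `N ≥ 6` (a fifth-order instance). [folklore] -/
theorem integral_trace_pow_five_eq_zero (hρ : IsSpecialUnitaryModel ρ) (hN : 2 ≤ N) (hN5 : N ≠ 5) :
    ∫ g, (ρ g).trace ^ 5 ∂haarProbability G = 0 := by
  refine integral_trace_pow_eq_zero ρ hρ (by omega) fun h => ?_
  have hle := Nat.le_of_dvd (by norm_num) h
  interval_cases N <;> omega

end Model

/-! ### The concrete groups `SU(N)` -/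

/-- ★★ **`∫_{SU(N)} (tr U)^j (conj tr U)^k dU = 0` whenever `N ∤ j − k`**, in the venture's vocabulary. [folklore] -/
theorem integral_trace_pow_mul_conj_pow_eq_zero_suN {N : ℕ} (hN : N ≠ 0) {j k : ℕ} (hjk : ¬ ((N : ℤ) ∣ (j : ℤ) - k)) :
    ∫ U, (U : Matrix (Fin N) (Fin N) ℂ).trace ^ j * (starRingEnd ℂ) (U : Matrix (Fin N) (Fin N) ℂ).trace ^ k
      ∂haarProbability (Matrix.specialUnitaryGroup (Fin N) ℂ) = 0 := by
  have h := integral_trace_pow_mul_conj_pow_eq_zero (fundamentalRep (Fin N)) (TorusAreaLaw.isSpecialUnitaryModel_fundamentalRep N)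
    hN hjk
  simpa only [fundamentalRep_apply] using h

end Summit.Ventures.YMGap.HaarCentreTwist
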